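import Summits.CriticalPhenomena.CardyFormulaZ2.Theorems.CardySusyWardParafermionFamiliesToSLESixHalfCRVertexRelationPairing
import Literature.Probability.LatticeModels.MedialWindingBridge
import Literature.Probability.LatticeModels.OnceChiralPhase

/-! # The Kirchhoff defect at spin `1/3`: the once/twice pair template (helper of `stub_kirchhoffIdentity`)

Line `Sketch` of the crux `CardySusyWard.WeakHolomorphy` (stmt-CriticalPhenomena-11292).  Pathwise, along a cut orbit, the
KIRCHHOFF DEFECT at the edge `e = cTgt p` is `kval = W(p) + W(p₂) − W(p.1, p.2+1) − W(p₂.1, p₂.2+1)` (arriving minus leaving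
spin-`1/3` dart weights `S2.dartW`, `p₂ = cornerPartner p`).  `kval_case1` is the pair template behind `S2.gval_case1` read for
`kval`: if `p` is a dart of the exploration of `ω` and `p₂` is not (a ONCE visit: `λ^C` in, `λ^{C+s}` out, `s = turnSign`,
`λ = e^{-iπ/6}`), the flipped configuration splices in the loop of `p₂` (a TWICE visit: `λ^C, λ^{C+2s}` in, `λ^{C-s}, λ^{C+s}`
out), so `kval(ω) + kval(ω') = λ^C (2 + λ^{2s} − 2λ^s − λ^{-s}) = onceKappa(s) · λ^C`; `kval_case0`: no visit.  The once-visit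
chiral phase `onceChiralPhase` (`Literature/…/OnceChiralPhase.lean`) is read on a cut orbit by
`onceChiralPhase_explorationList_once/twice/never`.  (Zhou 2024, eq. (102): the once/twice split, here resolved by chirality.)
-/

noncomputable section

namespace Summit.CriticalPhenomena.CardyFormulaZ2.Theorems.WeakHolomorphy.SplitBypass

open scoped BigOperators
open _root_.Literature.Probability.LatticeModels
open _root_.Literature.Probability.Percolation (BondConfig)
open Summit.CriticalPhenomena.CardyFormulaZ2.Theorems.ParafermionFamiliesToSLESix.StripAnchored.S2
  (dartW sixthPhase sixthPhase_add dartW_eq_zero dartW_eq_single exp_turnOf_eq_sixthPhase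
    exists_pred_of_cSrc_eq cSrc_eq_of_leaving turnSign_partner)

/-- Consecutive orbit corners chain: the `(j+1)`-st starts at the target edge of the `j`-th. [cite: Smirnov2001, §2] -/
theorem cSrc_cornerOrbit_succ_eq {β : BondConfig (Site 2)} {c₀ : Site 2 × Fin 4} (j : ℕ) :
    cSrc (cornerOrbit β c₀ (j + 1)) = cTgt (cornerOrbit β c₀ j) :=
  cSrc_nextCorner _

/-! ## The two constants through `sixthPhase` -/

/-- `e^{∓iπ/6} = sixthPhase (±1)`. [folklore] -/
theorem exp_pi_div_six_eq : Complex.exp (-(Real.pi / 6 : ℝ) * Complex.I) = sixthPhase 1 ∧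
    Complex.exp ((Real.pi / 6 : ℝ) * Complex.I) = sixthPhase (-1) := by
  unfold sixthPhase; constructor <;> (congr 1; push_cast; ring)

/-- `κ_L = 2 + λ·λ − 2λ − λ̄` with `λ = sixthPhase 1 = e^{-iπ/6}`, `λ̄ = sixthPhase (-1)`. [folklore] -/
theorem onceKappa_true_eq :
    onceKappa true = 2 + sixthPhase 1 * sixthPhase 1 - 2 * sixthPhase 1 - sixthPhase (-1) := by
  rw [onceKappa, if_pos rfl, exp_pi_div_six_eq.1, exp_pi_div_six_eq.2, sq]

/-- `κ_R = 2 + λ̄·λ̄ − 2λ̄ − λ`. [folklore] -/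
theorem onceKappa_false_eq :
    onceKappa false = 2 + sixthPhase (-1) * sixthPhase (-1) - 2 * sixthPhase (-1) - sixthPhase 1 := by
  rw [onceKappa, if_neg Bool.false_ne_true, exp_pi_div_six_eq.1, exp_pi_div_six_eq.2, sq]

/-! ## The once-visit phase read on a cut orbit -/

section Bridge

variable {β : BondConfig (Site 2)} {c₀ : Site 2 × Fin 4}

/-- The interior passage positions of the cut orbit `explorationList β c₀ N` at `z` are the positions
`0 < k < N` whose corner has source `z`. [folklore] -/
theorem mem_passagePositions_explorationList {N k : ℕ} {z : MedialVertex} :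
    k ∈ passagePositions (explorationList β c₀ N) z ↔ 0 < k ∧ k < N ∧ cSrc (cornerOrbit β c₀ k) = z := by
  unfold passagePositions
  rw [Finset.mem_filter, Finset.mem_range, length_explorationList']
  constructor
  · rintro ⟨-, h0, hk1, hz⟩
    refine ⟨h0, by omega, ?_⟩
    rwa [List.getElem?_eq_getElem (by rw [length_explorationList']; omega), getElem_explorationList',
      Option.some.injEq] at hz
  · rintro ⟨h0, hk, hz⟩
    refine ⟨by omega, h0, by omega, ?_⟩
    rw [List.getElem?_eq_getElem (by rw [length_explorationList']; omega), getElem_explorationList', hz]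

/-- The winding of the prefix of the cut orbit ending with its `j`-th dart: its first `j - 1` turns. [cite: Smirnov2010, §2.2] -/
theorem winding_prefix_explorationList {δ : ℝ} (hδ : δ ≠ 0) {N j : ℕ} (hj : j ≤ N) :
    Polyline.winding (((explorationList β c₀ N).map (medialPoint δ)).take (j + 1)) =
      ∑ i ∈ Finset.range (j - 1), turnOf β (cornerOrbit β c₀ i) := by
  rw [map_medialPoint_explorationList, take_orbitPts δ c₀ hj, Polyline.winding_eq_winding, winding_orbitPts hδ]

/-- The turning angle of the cut orbit at the position `j + 1` is the turn at the end of its `j`-th corner. [cite: Smirnov2001, §2] -/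
theorem turnAt_explorationList {δ : ℝ} (hδ : δ ≠ 0) {N j : ℕ} (hj : j + 1 < N) :
    turnAt (explorationList β c₀ N) δ (j + 1) = turnOf β (cornerOrbit β c₀ j) := by
  unfold turnAt
  rw [show j + 1 + 2 = (j + 2) + 1 by ring, winding_prefix_explorationList hδ (by omega : j + 2 ≤ N),
    winding_prefix_explorationList hδ (by omega : j + 1 ≤ N), show j + 2 - 1 = j + 1 by omega, Nat.add_sub_cancel,
    Finset.sum_range_succ, add_sub_cancel_left]

/-- **Never.** If no corner arriving at `e = cTgt r` is a dart of the cut orbit, the once-visit phase at `e` is `0`. [folklore] -/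
theorem onceChiralPhase_explorationList_never {δ σ : ℝ} {N : ℕ} {r : Site 2 × Fin 4}
    (h₁ : ∀ j < N, cornerOrbit β c₀ j ≠ r) (h₂ : ∀ j < N, cornerOrbit β c₀ j ≠ cornerPartner r) (b : Bool) :
    onceChiralPhase (explorationList β c₀ N) δ σ (cTgt r) b = 0 := by
  classical
  unfold onceChiralPhase
  refine Finset.sum_eq_zero fun k hk => ?_
  exfalso
  obtain ⟨h0, hkN, hz⟩ := mem_passagePositions_explorationList.1 hk
  obtain ⟨j, rfl⟩ : ∃ j, k = j + 1 := ⟨k - 1, by omega⟩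
  rw [cSrc_cornerOrbit_succ_eq, cTgt_eq_cTgt_iff] at hz
  exact hz.elim (h₁ j (by omega)) (h₂ j (by omega))

/-- **Twice.** If both corners arriving at `e = cTgt r` are darts of the cut orbit, at two times before
`N - 1`, the once-visit phase at `e` vanishes (two interior passages). [cite: Zhou2024SLE6BondZ2, eq. (102)] -/
theorem onceChiralPhase_explorationList_twice {δ σ : ℝ} {N i₁ i₂ : ℕ} {r : Site 2 × Fin 4} (h12 : i₁ ≠ i₂)
    (hi₁ : cornerOrbit β c₀ i₁ = r) (hi₁N : i₁ + 1 < N)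
    (hi₂ : cornerOrbit β c₀ i₂ = cornerPartner r) (hi₂N : i₂ + 1 < N) (b : Bool) :
    onceChiralPhase (explorationList β c₀ N) δ σ (cTgt r) b = 0 := by
  classical
  have hcard : (passagePositions (explorationList β c₀ N) (cTgt r)).card ≠ 1 := by
    intro h
    obtain ⟨a, ha⟩ := Finset.card_eq_one.1 h
    have m1 : i₁ + 1 ∈ passagePositions (explorationList β c₀ N) (cTgt r) :=
      mem_passagePositions_explorationList.2 ⟨Nat.succ_pos _, hi₁N, by rw [cSrc_cornerOrbit_succ_eq, hi₁]⟩
    have m2 : i₂ + 1 ∈ passagePositions (explorationList β c₀ N) (cTgt r) :=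
      mem_passagePositions_explorationList.2 ⟨Nat.succ_pos _, hi₂N, by rw [cSrc_cornerOrbit_succ_eq, hi₂, cTgt_partner]⟩
    rw [ha, Finset.mem_singleton] at m1 m2
    omega
  unfold onceChiralPhase
  exact Finset.sum_eq_zero fun k _ => if_neg fun h => hcard h.1

open scoped Classical in
/-- **Once.** If `r = orb i₁` (`i₁ + 1 < N`) is the only dart of the cut orbit arriving at `e = cTgt r`,
the once-visit phase at `e` with chirality `b` is the arrival weight `sixthPhase (turnCount i₁)` if
(`e` closed, i.e. a left turn) `↔ b`, and `0` otherwise. [cite: Zhou2024SLE6BondZ2, eq. (102)] -/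
theorem onceChiralPhase_explorationList_once {δ : ℝ} (hδ : δ ≠ 0) {N i₁ : ℕ} {r : Site 2 × Fin 4}
    (hi₁ : cornerOrbit β c₀ i₁ = r) (hi₁N : i₁ + 1 < N)
    (uP : ∀ j < N, cornerOrbit β c₀ j = r → j = i₁) (h₂ : ∀ j < N, cornerOrbit β c₀ j ≠ cornerPartner r) (b : Bool) :
    onceChiralPhase (explorationList β c₀ N) δ (1 / 3) (cTgt r) b =
      if (cTgt r ∉ β ↔ b = true) then sixthPhase (turnCount β c₀ i₁) else 0 := by
  classical
  have hP : passagePositions (explorationList β c₀ N) (cTgt r) = {i₁ + 1} := by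
    ext k
    rw [mem_passagePositions_explorationList, Finset.mem_singleton]
    constructor
    · rintro ⟨h0, hk, hz⟩
      obtain ⟨j, rfl⟩ : ∃ j, k = j + 1 := ⟨k - 1, by omega⟩
      rw [cSrc_cornerOrbit_succ_eq, cTgt_eq_cTgt_iff] at hz
      rcases hz with h | h
      · rw [uP j (by omega) h]
      · exact absurd h (h₂ j (by omega))
    · rintro rfl
      exact ⟨Nat.succ_pos _, hi₁N, by rw [cSrc_cornerOrbit_succ_eq, hi₁]⟩
  have hπ : 0 < Real.pi / 2 := by positivity
  have hturn : 0 < turnOf β r ↔ cTgt r ∉ β := by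
    unfold turnOf
    by_cases h : cTgt r ∈ β
    · rw [if_pos h]; exact ⟨fun h' => absurd h' (by linarith), fun h' => absurd h h'⟩
    · rw [if_neg h]; exact ⟨fun _ => h, fun _ => hπ⟩
  unfold onceChiralPhase
  rw [hP, Finset.sum_singleton, Finset.card_singleton, turnAt_explorationList hδ hi₁N, hi₁,
    winding_prefix_explorationList hδ (by omega : i₁ + 1 ≤ N), Nat.add_sub_cancel,
    ← exp_turnOf_eq_sixthPhase β c₀ i₁]
  by_cases hb : (cTgt r ∉ β ↔ b = true)
  · rw [if_pos hb, if_pos ⟨rfl, hturn.trans hb⟩]; congr 1; push_cast; ring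
  · rw [if_neg hb, if_neg fun h => hb (hturn.symm.trans h.2)]

end Bridge

/-! ## The pair template: once-visit against twice-visit -/

/-! The KIRCHHOFF DEFECT `kval` (`in − out`) at the edge `e = cTgt q` along a cut orbit: the weights `dartW` of the two arriving
corners `q`, `q₂ = cornerPartner q` minus those of the two leaving corners `(q.1, q.2 + 1)`, `(q₂.1, q₂.2 + 1)` (written out). -/

section Orbit

variable {D : DiscreteDobrushin} {ω ω' : BondConfig (Site 2)} {c₀ p : Site 2 × Fin 4}

/-- A dart of an exploration arriving at an edge with all faces at its vertex inner is not the last dart. [folklore] -/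
theorem succ_lt_of_arrives {N j : ℕ} {q : Site 2 × Fin 4} (hN : ¬ D.IsInnerFace (cFace (cornerOrbit (D.bcBondConfig ω) c₀ N)))
    (hq : ∀ i, D.IsInnerFace (faceAt q.1 i)) (hj : cornerOrbit (D.bcBondConfig ω) c₀ j = q) (hjN : j < N) : j + 1 < N := by
  refine lt_of_le_of_ne (by omega) fun h => hN ?_
  rw [← h, cornerOrbit_succ, hj]
  by_cases he : cTgt q ∈ D.bcBondConfig ω
  · rw [cFace_nextCorner_of_mem he]; exact hq q.2
  · rw [cFace_nextCorner_of_not_mem he]; exact hq _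

/-- **Case 0**: if neither corner arriving at `e` is a dart of the exploration, nothing arrives at or leaves `e`. [folklore] -/
theorem kval_case0 (hc₀ : D.IsStartCorner c₀) (hB : ∀ x ∈ cTgt p, x ∉ D.zdArcB) {N : ℕ}
    (h₁ : ∀ i < N, cornerOrbit (D.bcBondConfig ω) c₀ i ≠ p)
    (h₂ : ∀ i < N, cornerOrbit (D.bcBondConfig ω) c₀ i ≠ cornerPartner p) :
    dartW (D.bcBondConfig ω) c₀ p N + dartW (D.bcBondConfig ω) c₀ (cornerPartner p) N -
      dartW (D.bcBondConfig ω) c₀ (p.1, p.2 + 1) N - dartW (D.bcBondConfig ω) c₀ ((cornerPartner p).1, (cornerPartner p).2 + 1) N = 0 := by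
  have hleave : ∀ r : Site 2 × Fin 4, (r = (p.1, p.2 + 1) ∨ r = ((cornerPartner p).1, (cornerPartner p).2 + 1)) →
      ∀ j < N, cornerOrbit (D.bcBondConfig ω) c₀ j ≠ r := by
    intro r hr j hj hjr
    obtain ⟨j', rfl, h⟩ := exists_pred_of_cSrc_eq hc₀ hB (hjr ▸ cSrc_eq_of_leaving r hr)
    rcases h with h | h
    · exact h₁ j' (by omega) h
    · exact h₂ j' (by omega) h
  rw [dartW_eq_zero (hleave _ (Or.inl rfl)), dartW_eq_zero (hleave _ (Or.inr rfl)), dartW_eq_zero h₁, dartW_eq_zero h₂]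
  ring

/-- **The pair template (case 1)** (the bookkeeping of `S2.gval_case1`). `p = orb i₁` is a dart of the
exploration of `ω`, its partner `p₂` is not; `β`, `β'` agree off `e = cTgt p` and differ at `e`; all faces at
both endpoints of `e` are inner; the loop of `p₂` under `β` (minimal period `Q`) turns by `4 · turnSign β p`.
Then the darts at `e` weigh `λ^C` (in), `λ^{C+s}` (out) for `β` and `λ^C, λ^{C+2s}` (in), `λ^{C-s}, λ^{C+s}`
(out) for the spliced `β'` (`s = turnSign β p`), and the two Kirchhoff defects add up to `κ_s λ^C`
(`onceKappa true` for `s = 1`, a left turn across the closed `e`; `onceKappa false` for `s = -1`).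
[cite: Zhou2024SLE6BondZ2, eq. (102)] -/
theorem kval_case1 (hD : D.IsZdAdmissible) (hc₀ : D.IsStartCorner c₀)
    (hagree : ∀ e, e ≠ cTgt p → (e ∈ D.bcBondConfig ω' ↔ e ∈ D.bcBondConfig ω))
    (hdiff : ¬ (cTgt p ∈ D.bcBondConfig ω' ↔ cTgt p ∈ D.bcBondConfig ω)) (hB : ∀ x ∈ cTgt p, x ∉ D.zdArcB)
    (hx : ∀ j, D.IsInnerFace (faceAt p.1 j)) (hy : ∀ j, D.IsInnerFace (faceAt (p.1 + cornerUnit (p.2 + 1)) j))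
    {N P Q i₁ : ℕ} (hN : ¬ D.IsInnerFace (cFace (cornerOrbit (D.bcBondConfig ω) c₀ N)))
    (hlt : ∀ k < N, D.IsInnerFace (cFace (cornerOrbit (D.bcBondConfig ω) c₀ k))) (hP0 : 0 < P)
    (hP : cornerOrbit (D.bcBondConfig ω) c₀ P = c₀)
    (hPmin : ∀ s, 0 < s → s < P → cornerOrbit (D.bcBondConfig ω) c₀ s ≠ c₀)
    (hQ0 : 0 < Q) (hQ : cornerOrbit (D.bcBondConfig ω) (cornerPartner p) Q = cornerPartner p)
    (hQmin : ∀ s, 0 < s → s < Q → cornerOrbit (D.bcBondConfig ω) (cornerPartner p) s ≠ cornerPartner p)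
    (hi₁ : cornerOrbit (D.bcBondConfig ω) c₀ i₁ = p) (hi₁N : i₁ < N)
    (h₂ : ∀ i < N, cornerOrbit (D.bcBondConfig ω) c₀ i ≠ cornerPartner p)
    (hS : ∑ m ∈ Finset.range Q, turnSign (D.bcBondConfig ω) (cornerOrbit (D.bcBondConfig ω) (cornerPartner p) m) =
      4 * turnSign (D.bcBondConfig ω) p) :
    (dartW (D.bcBondConfig ω) c₀ p N + dartW (D.bcBondConfig ω) c₀ (cornerPartner p) N - dartW (D.bcBondConfig ω) c₀ (p.1, p.2 + 1) N -
          dartW (D.bcBondConfig ω) c₀ ((cornerPartner p).1, (cornerPartner p).2 + 1) N) +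
        (dartW (D.bcBondConfig ω') c₀ p (N + Q) + dartW (D.bcBondConfig ω') c₀ (cornerPartner p) (N + Q) -
          dartW (D.bcBondConfig ω') c₀ (p.1, p.2 + 1) (N + Q) -
          dartW (D.bcBondConfig ω') c₀ ((cornerPartner p).1, (cornerPartner p).2 + 1) (N + Q)) =
      (if turnSign (D.bcBondConfig ω) p = 1 then onceKappa true else onceKappa false) *
        sixthPhase (turnCount (D.bcBondConfig ω) c₀ i₁) := by
  classical
  set β := D.bcBondConfig ω
  set β' := D.bcBondConfig ω'
  set p₂ := cornerPartner p with hp₂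
  have hinj : ∀ a b, a < N → b < N → cornerOrbit β c₀ a = cornerOrbit β c₀ b → a = b := by
    intro a b ha hb h
    by_contra hne
    rcases Nat.lt_or_gt_of_ne hne with hab | hab
    · exact cornerOrbit_ne hD hc₀ hab (fun k hk => hlt k (by omega)) h
    · exact cornerOrbit_ne hD hc₀ hab (fun k hk => hlt k (by omega)) h.symm
  -- the loop never meets the interface cycle
  have hdisj : ∀ m s, cornerOrbit β p₂ m ≠ cornerOrbit β c₀ s := fun m s =>
    loop_ne_of_never_arrives hD hc₀ hy hN hlt hP0 hP hPmin h₂ m s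
  obtain ⟨hpre, hloop, htail, -, -⟩ := cornerOrbit_toggle_case1 hD hc₀ hagree hdiff hx hy hN hlt hP0 hP hPmin hQ0 hQ
    hQmin hi₁ hi₁N h₂
  have hB' : ∀ x ∈ cTgt p₂, x ∉ D.zdArcB := by rw [hp₂, cTgt_partner]; exact hB
  -- ### the darts of `β` at `e`
  have hsucc : cornerOrbit β c₀ (i₁ + 1) = nextCorner β p := by rw [← hi₁]; rfl
  have hi₁N' : i₁ + 1 < N := succ_lt_of_arrives hN hx hi₁ hi₁N
  have uP : ∀ j < N, cornerOrbit β c₀ j = p ↔ j = i₁ := fun j hj =>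
    ⟨fun h => hinj j i₁ hj hi₁N (h.trans hi₁.symm), fun h => h ▸ hi₁⟩
  have uS : ∀ j < N, cornerOrbit β c₀ j = nextCorner β p ↔ j = i₁ + 1 := by
    intro j hj
    refine ⟨fun h => ?_, fun h => h ▸ hsucc⟩
    obtain ⟨j', rfl, hj'⟩ := exists_pred_of_cSrc_eq hc₀ hB (by rw [h, cSrc_nextCorner])
    rcases hj' with hj' | hj'
    · rw [(uP j' (by omega)).1 hj']
    · exact absurd hj' (h₂ j' (by omega))
  have zS : ∀ j < N, cornerOrbit β c₀ j ≠ nextCorner β p₂ := by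
    intro j hj h
    obtain ⟨j', rfl, hj'⟩ := exists_pred_of_cSrc_eq hc₀ hB (by rw [h, cSrc_nextCorner, hp₂, cTgt_partner])
    rcases hj' with hj' | hj'
    · have : nextCorner β p = nextCorner β p₂ := by rw [← hj', ← h]; rfl
      exact partner_ne p (nextCorner_injective this).symm
    · exact h₂ j' (by omega) hj'
  -- ### the darts of `β'` at `e` (exit time `N + Q`)
  have hloopQ : cornerOrbit β' c₀ (i₁ + Q) = p₂ := by
    have := hloop (Q - 1) (by omega)
    rwa [show i₁ + 1 + (Q - 1) = i₁ + Q by omega, Nat.sub_add_cancel hQ0, hQ] at this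
  have hcls : ∀ j < N + Q, (j ≤ i₁ ∧ cornerOrbit β' c₀ j = cornerOrbit β c₀ j) ∨
      (i₁ < j ∧ j ≤ i₁ + Q ∧ cornerOrbit β' c₀ j = cornerOrbit β p₂ (j - i₁)) ∨ (i₁ + Q < j ∧ cornerOrbit β' c₀ j = cornerOrbit β c₀ (j - Q)) := by
    intro j hj
    by_cases hj1 : j ≤ i₁
    · exact Or.inl ⟨hj1, hpre j hj1⟩
    · by_cases hj2 : j ≤ i₁ + Q
      · refine Or.inr (Or.inl ⟨by omega, hj2, ?_⟩)
        have := hloop (j - i₁ - 1) (by omega)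
        rwa [show i₁ + 1 + (j - i₁ - 1) = j by omega, show j - i₁ - 1 + 1 = j - i₁ by omega] at this
      · refine Or.inr (Or.inr ⟨by omega, ?_⟩)
        have := htail (j - i₁ - Q - 1) (by omega)
        rwa [show i₁ + Q + 1 + (j - i₁ - Q - 1) = j by omega, show i₁ + 1 + (j - i₁ - Q - 1) = j - Q by omega] at this
  have uP' : ∀ j < N + Q, cornerOrbit β' c₀ j = p ↔ j = i₁ := by
    intro j hj
    refine ⟨fun h => ?_, fun h => by rw [h, hpre i₁ le_rfl, hi₁]⟩
    rcases hcls j hj with ⟨hj1, hoj⟩ | ⟨hj1, hj2, hoj⟩ | ⟨hj1, hoj⟩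
    · exact (uP j (by omega)).1 (hoj ▸ h)
    · exact absurd ((hoj.symm.trans h).trans hi₁.symm) (hdisj _ _)
    · have := (uP (j - Q) (by omega)).1 (hoj ▸ h); omega
  have uP₂' : ∀ j < N + Q, cornerOrbit β' c₀ j = p₂ ↔ j = i₁ + Q := by
    intro j hj
    refine ⟨fun h => ?_, fun h => h ▸ hloopQ⟩
    rcases hcls j hj with ⟨hj1, hoj⟩ | ⟨hj1, hj2, hoj⟩ | ⟨hj1, hoj⟩
    · exact absurd (hoj ▸ h) (h₂ j (by omega))
    · by_contra hne
      exact hQmin (j - i₁) (by omega) (by omega) (hoj.symm.trans h)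
    · exact absurd (hoj ▸ h) (h₂ (j - Q) (by omega))
  have hsucc' : cornerOrbit β' c₀ (i₁ + 1) = nextCorner β' p := by rw [← (uP' i₁ (by omega)).2 rfl]; rfl
  have hsucc₂' : cornerOrbit β' c₀ (i₁ + Q + 1) = nextCorner β' p₂ := by rw [← hloopQ]; rfl
  have hnext' : nextCorner β' p = nextCorner β p₂ := by
    rw [nextCorner_toggle hagree hdiff, Equiv.swap_apply_left]
  have hnext₂' : nextCorner β' p₂ = nextCorner β p := by
    rw [nextCorner_toggle hagree hdiff, hp₂, Equiv.swap_apply_right]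
  have uS' : ∀ j < N + Q, cornerOrbit β' c₀ j = nextCorner β' p ↔ j = i₁ + 1 := by
    intro j hj
    refine ⟨fun h => ?_, fun h => h ▸ hsucc'⟩
    obtain ⟨j', rfl, hj'⟩ := exists_pred_of_cSrc_eq (ω := ω') hc₀ hB (by rw [h, cSrc_nextCorner])
    rcases hj' with hj' | hj'
    · rw [(uP' j' (by omega)).1 hj']
    · have hn : nextCorner β' p₂ = nextCorner β' p := by rw [hp₂, ← hj', ← h]; rfl
      exact absurd (nextCorner_injective hn) (partner_ne p)
  have uS₂' : ∀ j < N + Q, cornerOrbit β' c₀ j = nextCorner β' p₂ ↔ j = i₁ + Q + 1 := by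
    intro j hj
    refine ⟨fun h => ?_, fun h => h ▸ hsucc₂'⟩
    obtain ⟨j', rfl, hj'⟩ := exists_pred_of_cSrc_eq (ω := ω') hc₀ hB' (by rw [h, cSrc_nextCorner])
    rw [hp₂, partner_partner] at hj'
    rcases hj' with hj' | hj'
    · rw [(uP₂' j' (by omega)).1 hj']
    · have hn : nextCorner β' p = nextCorner β' p₂ := by rw [← hj', ← h]; rfl
      exact absurd (nextCorner_injective hn).symm (partner_ne p)
  -- ### turn counts
  set C := turnCount β c₀ i₁ with hC
  have he'iff : cTgt p ∈ β' ↔ cTgt p ∉ β := ⟨fun h' h => hdiff ⟨fun _ => h, fun _ => h'⟩,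
    fun h => by_contra fun h' => hdiff ⟨fun h'' => absurd h'' h', fun h'' => absurd h'' h⟩⟩
  have htgt : ∀ j < N, j ≠ i₁ → cTgt (cornerOrbit β c₀ j) ≠ cTgt p := by
    intro j hj h1 h
    rcases cTgt_eq_cTgt_iff.1 h with h | h
    · exact h1 (hinj j i₁ hj hi₁N (h.trans hi₁.symm))
    · exact h₂ j hj h
  have hC' : turnCount β' c₀ i₁ = C :=
    turnCount_congr_prefix hpre fun j hj => hagree _ (htgt j (by omega) (by omega))
  have hLtgt : ∀ m, 0 < m → m < Q → cTgt (cornerOrbit β p₂ m) ≠ cTgt p := by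
    intro m hm hmQ h
    rcases cTgt_eq_cTgt_iff.1 h with h | h
    · exact hdisj m i₁ (h.trans hi₁.symm)
    · exact hQmin m hm hmQ h
  have hS1 : ∑ m ∈ Finset.range (Q - 1), turnSign β (cornerOrbit β p₂ (m + 1)) = 3 * turnSign β p := by
    have h := hS
    rw [show Q = (Q - 1) + 1 by omega, Finset.sum_range_succ'] at h
    have h0 : turnSign β (cornerOrbit β p₂ 0) = turnSign β p := turnSign_partner β p
    rw [h0] at h; linear_combination h
  have hCQ' : turnCount β' c₀ (i₁ + Q) = C + turnSign β' p + 3 * turnSign β p := by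
    rw [turnCount_add, show Q = (Q - 1) + 1 by omega, Finset.sum_range_succ', add_zero,
      hpre i₁ le_rfl, hi₁, hC', ← hS1]
    have hterm : ∀ m ∈ Finset.range (Q - 1),
        turnSign β' (cornerOrbit β' c₀ (i₁ + (m + 1))) = turnSign β (cornerOrbit β p₂ (m + 1)) := by
      intro m hm
      rw [Finset.mem_range] at hm
      rw [show i₁ + (m + 1) = i₁ + 1 + m by omega, hloop m (by omega)]
      exact turnSign_congr (hagree _ (hLtgt (m + 1) (Nat.succ_pos _) (by omega)))
    rw [Finset.sum_congr rfl hterm]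
    ring
  have hCs : turnCount β c₀ (i₁ + 1) = C + turnSign β p := by rw [turnCount_succ, hi₁]
  have hCs' : turnCount β' c₀ (i₁ + 1) = C + turnSign β' p := by rw [turnCount_succ, hpre i₁ le_rfl, hi₁, hC']
  have hCQs' : turnCount β' c₀ (i₁ + Q + 1) = C + turnSign β' p + 3 * turnSign β p + turnSign β' p := by
    rw [turnCount_succ, hloopQ, hCQ', turnSign_partner]
  -- ### the weights
  have wP : dartW β c₀ p N = sixthPhase C := dartW_eq_single hi₁N uP
  have wP₂ : dartW β c₀ p₂ N = 0 := dartW_eq_zero h₂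
  have wS : dartW β c₀ (nextCorner β p) N = sixthPhase (C + turnSign β p) := by
    rw [dartW_eq_single hi₁N' uS, hCs]
  have wS₂ : dartW β c₀ (nextCorner β p₂) N = 0 := dartW_eq_zero zS
  have wP' : dartW β' c₀ p (N + Q) = sixthPhase C := by rw [dartW_eq_single (by omega) uP', hC']
  have wP₂' : dartW β' c₀ p₂ (N + Q) = sixthPhase (C + turnSign β' p + 3 * turnSign β p) := by
    rw [dartW_eq_single (by omega) uP₂', hCQ']
  have wS' : dartW β' c₀ (nextCorner β p₂) (N + Q) = sixthPhase (C + turnSign β' p) := by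
    rw [← hnext', dartW_eq_single (by omega) uS', hCs']
  have wS₂' : dartW β' c₀ (nextCorner β p) (N + Q) = sixthPhase (C + turnSign β' p + 3 * turnSign β p + turnSign β' p) := by
    rw [← hnext₂', dartW_eq_single (by omega) uS₂', hCQs']
  -- ### the algebra, in the two cases `e` open / closed in `β`
  have e1 : sixthPhase (C + -1) = sixthPhase C * sixthPhase (-1) := sixthPhase_add _ _
  have e2 : sixthPhase (C + 1) = sixthPhase C * sixthPhase 1 := sixthPhase_add _ _
  by_cases he : cTgt p ∈ β
  · -- `e` open in `β`: `p` is followed, `s = -1`, a right turn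
    have he' : cTgt p ∉ β' := fun h => (he'iff.1 h) he
    have hs : turnSign β p = -1 := turnSign_of_mem he
    have hs' : turnSign β' p = 1 := turnSign_of_not_mem he'
    have n1 : nextCorner β p = (p₂.1, p₂.2 + 1) := by
      rw [nextCorner_of_mem he, hp₂, cornerPartner]; simp only; rw [fin4_add_two_add_one]
    have n2 : nextCorner β p₂ = (p.1, p.2 + 1) := nextCorner_partner_of_mem he
    rw [hs] at wS; rw [hs, hs'] at wP₂' wS₂'; rw [hs'] at wS'
    rw [if_neg (by rw [hs]; decide), ← n1, ← n2, wP, wP₂, wS, wS₂, wP', wP₂', wS', wS₂', onceKappa_false_eq]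
    have e3 : sixthPhase (C + 1 + 3 * -1) = sixthPhase C * (sixthPhase (-1) * sixthPhase (-1)) := by
      rw [← sixthPhase_add, ← sixthPhase_add]; congr 1; ring
    have e4 : sixthPhase (C + 1 + 3 * -1 + 1) = sixthPhase C * sixthPhase (-1) := by
      rw [← sixthPhase_add]; congr 1; ring
    rw [e1, e2, e3, e4]; ring
  · -- `e` closed in `β`: `p` crosses, `s = +1`, a left turn
    have he' : cTgt p ∈ β' := he'iff.2 he
    have hs : turnSign β p = 1 := turnSign_of_not_mem he
    have hs' : turnSign β' p = -1 := turnSign_of_mem he'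
    have n1 : nextCorner β p = (p.1, p.2 + 1) := nextCorner_of_not_mem he
    have n2 : nextCorner β p₂ = (p₂.1, p₂.2 + 1) := by
      rw [hp₂, nextCorner_partner_of_not_mem he, cornerPartner]; simp only; rw [fin4_add_two_add_one]
    rw [hs] at wS; rw [hs, hs'] at wP₂' wS₂'; rw [hs'] at wS'
    rw [if_pos hs, ← n1, ← n2, wP, wP₂, wS, wS₂, wP', wP₂', wS', wS₂', onceKappa_true_eq]
    have e3 : sixthPhase (C + -1 + 3 * 1) = sixthPhase C * (sixthPhase 1 * sixthPhase 1) := by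
      rw [← sixthPhase_add, ← sixthPhase_add]; congr 1; ring
    have e4 : sixthPhase (C + -1 + 3 * 1 + -1) = sixthPhase C * sixthPhase 1 := by
      rw [← sixthPhase_add]; congr 1; ring
    rw [e1, e2, e3, e4]; ring

end Orbit

/-- **Registered one-line form of the pair template** `kval_case1` (helper of `stub_kirchhoffIdentity`, line `Sketch` of
stmt-CriticalPhenomena-11292). [cite: Zhou2024SLE6BondZ2, eq. (102)] -/
theorem stub_kirchhoffPairing : ∀ (D : DiscreteDobrushin) (ω ω' : BondConfig (Site 2)) (c₀ p : Site 2 × Fin 4) (N P Q i₁ : ℕ), D.IsZdAdmissible → D.IsStartCorner c₀ → (∀ e, e ≠ cTgt p → (e ∈ D.bcBondConfig ω' ↔ e ∈ D.bcBondConfig ω)) → ¬ (cTgt p ∈ D.bcBondConfig ω' ↔ cTgt p ∈ D.bcBondConfig ω) → (∀ x ∈ cTgt p, x ∉ D.zdArcB) → (∀ j, D.IsInnerFace (faceAt p.1 j)) → (∀ j, D.IsInnerFace (faceAt (p.1 + cornerUnit (p.2 + 1)) j)) → ¬ D.IsInnerFace (cFace (cornerOrbit (D.bcBondConfig ω) c₀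 N)) → (∀ k < N, D.IsInnerFace (cFace (cornerOrbit (D.bcBondConfig ω) c₀ k))) → 0 < P → cornerOrbit (D.bcBondConfig ω) c₀ P = c₀ → (∀ s, 0 < s → s < P → cornerOrbit (D.bcBondConfig ω) c₀ s ≠ c₀) → 0 < Q → cornerOrbit (D.bcBondConfig ω) (cornerPartner p) Q = cornerPartner p → (∀ s, 0 < s → s < Q → cornerOrbit (D.bcBondConfig ω) (cornerPartner p) s ≠ cornerPartner p) → cornerOrbit (D.bcBondConfig ω) c₀ i₁ = p → i₁ < N → (∀ i < N, cornerOrbit (D.bcBondConfig ω) c₀ i ≠ cornerPartner p) → ∑ m ∈ Finset.range Q, turnSign (D.bcBondConfig ω) (cornerOrbit (D.bcBondConfig ω) (cornerPartner p) m) = 4 * turnSign (D.bcBondConfig ω) p → (Summit.CriticalPhenomena.CardyFormulaZ2.Theorems.ParafermionFamiliesToSLESix.StripAnchored.S2.dartW (D.bcBondConfig ω) c₀ p N + Summit.CriticalPhenomena.CardyFormulaZ2.Theorems.ParafermionFamiliesToSLESix.StripAnchored.S2.dartW (D.bcBondConfig ω) c₀ (cornerPartner p) N - Summit.CriticalPhenomena.CardyFormulaZ2.Theorems.ParafermionFamiliesToSLESix.StripAnchored.S2.dartW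 (D.bcBondConfig ω) c₀ (p.1, p.2 + 1) N - Summit.CriticalPhenomena.CardyFormulaZ2.Theorems.ParafermionFamiliesToSLESix.StripAnchored.S2.dartW (D.bcBondConfig ω) c₀ ((cornerPartner p).1, (cornerPartner p).2 + 1) N) + (Summit.CriticalPhenomena.CardyFormulaZ2.Theorems.ParafermionFamiliesToSLESix.StripAnchored.S2.dartW (D.bcBondConfig ω') c₀ p (N + Q) + Summit.CriticalPhenomena.CardyFormulaZ2.Theorems.ParafermionFamiliesToSLESix.StripAnchored.S2.dartW (D.bcBondConfig ω') c₀ (cornerPartner p) (N + Q) - Summit.CriticalPhenomena.CardyFormulaZ2.Theorems.ParafermionFamiliesToSLESix.StripAnchored.S2.dartW (D.bcBondConfig ω') c₀ (p.1, p.2 + 1) (N + Q) - Summit.CriticalPhenomena.CardyFormulaZ2.Theorems.ParafermionFamiliesToSLESix.StripAnchored.S2.dartW (D.bcBondConfig ω') c₀ ((cornerPartner p).1, (cornerPartner p).2 + 1) (N + Q)) = (if turnSign (D.bcBondConfig ω) p = 1 then onceKappa true else onceKappa false) * Summit.CriticalPhenomena.CardyFormulaZ2.Theorems.ParafermionFamiliesToSLESix.StripAnchored.S2.sixthPhase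 (turnCount (D.bcBondConfig ω) c₀ i₁) :=
  fun _ _ _ _ _ _ _ _ _ hD hc₀ hagree hdiff hB hx hy hN hlt hP0 hP hPmin hQ0 hQ hQmin hi₁ hi₁N h₂ hS =>
    kval_case1 hD hc₀ hagree hdiff hB hx hy hN hlt hP0 hP hPmin hQ0 hQ hQmin hi₁ hi₁N h₂ hS

end Summit.CriticalPhenomena.CardyFormulaZ2.Theorems.WeakHolomorphy.SplitBypass

end
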